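import Mathlib
import HarnessLib
import HarnessLib.Audit
import Summits.FinalStateConjecture.Statement
import Literature.Geometry.Lorentzian.ReggeWheelerTortoise
import Literature.Geometry.Lorentzian.ReggeWheelerChannels
import Summits.FinalStateConjecture.FinalStateConjecture.Theorems.PhotonSphereChannelsFarChannels
import Summits.FinalStateConjecture.FinalStateConjecture.Theorems.PhotonSphereChannelsUniformPhotonSphereChannelsR
import Summits.FinalStateConjecture.FinalStateConjecture.Theorems.PhotonSphereChannelsAssemblyFrameT2
import HarnessLib.Audit.Status.Attr

/-!
Route: PhotonSphereChannels

DORMANT since 2026-08-25T17:29:14Z (reconciler: no traction for 7.9 d (last activity item-evidence-added at 2026-08-17T19:19:28Z); parked, not closed — `ledger route dormant route-FinalStateConjecture-PhotonSphereChannels --off` to reac) — unstaffed, not closed; items shared with open routes are served there. `ledger route dormant <id> --off` reactivates.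

# Route PhotonSphereChannels — Channels of energy outside the logarithmic trapping shadow of the
photon sphere resolve tame exteriors into Kerr

It suffices to show X = K1R ∧ K2R ∧ K3 (card channels-of-energy-photon-sphere, spine; REPAIRED
2026-08-16 after the rank-2 crux K1
`UniformPhotonSphereChannels` was refuted-substantive by `Theorems.not_UniformPhotonSphereChannels`,
p75070). K1R
(UniformPhotonSphereChannelsR, the declared pivot): for the Regge–Wheeler family (spins s = 0,1,2,
all ℓ ≥ s) on Schwarzschild, in the
tortoise line x with r′(x) = 1 − 2M/r and centre x_c, r(x_c) = 3M, the TWO-ENDED exterior channel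
energy (energy left on
{|x − x_c| > ρ + |t|} as t → +∞ PLUS as t → −∞: radiation through 𝓘⁺/𝓘⁻ and through 𝓗⁺/𝓗⁻) controls
c(M)·dist²(data, P_ℓ(ρ)) in the
exterior energy norm with c(M) UNIFORM in s, ℓ, ρ — for every ball radius ρ ≥ ρ₀(M) + C(M)·log(ℓ+1)
(the LOG-BALL: a mode of angular number ℓ
is excised on the tortoise interval of half-width C log ℓ about the photon sphere, the
physical-space shadow of the redshift/trapping
e-folding; the refuted K1 asked this at a FIXED ball and died on horizon-side rest packets), where
P_ℓ(ρ) = solutions polynomial in t on the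
exterior cone (static multipoles, linearised charges, tidal jets and their t-descendants). K2R
(ChannelsResolveTameDevelopmentsR, card items
4–6 in DKM architecture): K1R ⇒ every MGHD of admissible data with complete 𝓘⁺ whose outer region
has C³-bounded geometry at a uniform scale
and carries no extremal-Kerr remnant settles down: an honest FinalStateDecomposition with O = J⁺(Σ)
∩ I⁻(charts), every future-complete
normalised null ray from Σ staying in closure O (RaysStayInClosure), honest-radii
HasExhaustiveCharts and future-oriented charts
(IsFutureOriented) — the T2 conclusion (summit re-typed 2026-08-16T21:19Z, p126844; K2R restated at
rev 15).
K3 (TameCensorship, the declared complement, NOT the mechanism): TAME-Christodoulou-generic (T2: one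
fixed end, `IsTameChristodoulouGeneric`,
rev 15) admissible data have an MGHD, and all their MGHDs have
complete 𝓘⁺, tame outer region and no extremal remnant (WCC + a-priori tameness + dynamical third
law, as ONE generic property).
W (WindowedShellChannels, crux rank 5, filed at the route choice 2026-08-16 as the genuinely
different linear crux; NOT a hypothesis
of `closes`): for data SUPPORTED OFF the shell {|x − x_c| ≤ ρ}, a fixed fraction c(M,ρ) of the total
energy is radiated, in at least one
time direction, ahead of the light cones from the LAGGED edges x_c ± (ρ − h(M,ρ)) — two-ended
channels with a window lag (h > 4M ln 2 is
necessary by the refutation's midpoint law) and no kernel: the hedge to K1R's far side and the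
linear no-parking law behind K2R.
FixedModeChannels (K1R per mode; its near half is landed as Theorems.nearHalfLineChannels) is the
first provable rung; K1 (refuted),
the old K2 = K1 → N (ex falso) and the pre-repair frames were dropped at rev 7 and remain as record
lines of the file.
Lean: `UniformPhotonSphereChannelsR ∧ ChannelsResolveTameDevelopmentsR ∧ TameCensorship`

## Assembly
Pure logic, PROVED in the planner's Sketch.lean/glue.lean as `closes` (lean check rc 0, 0 sorries;
same proof as the rev-4 deciding theorem with
the repaired hypotheses): fix Σ and an admissible datum D in the exceptional set of the final-state
property P. The tame property Q of
TameCensorship implies P pointwise on admissible data: anti-vacuity and completeness are copied;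
ChannelsResolveTameDevelopmentsR fed with
UniformPhotonSphereChannelsR turns (complete ∧ tame) into an honest exhaustive, future-oriented
decomposition d with ray closure; each hole of d is sub-extremal because |aᵢ| ≤ Mᵢ
(structure field) and |aᵢ| = Mᵢ would make d.chart i a C²-converging late chart from an extremal
Kerr exterior, excluded by the
no-extremal-remnant clause. Hence D is Q-exceptional, TameCensorship supplies the tame (one fixed
end), immersed, injective admissible curve through D, and its other
members satisfy Q hence P: this is `IsTameChristodoulouGeneric … P 1`, i.e. `FinalStateConjecture`
(tame genericity is monotone in the
property exactly as the topology-free notion was: end, family, tameness and immersion are kept, only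
exceptional-set membership moves). The deciding theorem is
`closes : UniformPhotonSphereChannelsR → ChannelsResolveTameDevelopmentsR → TameCensorship →
FinalStateConjecture` (axioms
propext/Classical.choice/Quot.sound). The Assembly item stmt-FinalStateConjecture-17432, `(K1R ∧ K2R
∧ K3) → FinalStateConjecture` (re-keyed at rev 15 after the T2
restatement of K2R/K3), is the uncurried frame of `closes` (bookkeeping, `fun h => closes h.1 h.2.1
h.2.2`; δ-equal to the landed Theses-free
frame `Theorems.PhotonSphereChannels.assemblyT2_frame_proof`, by which it can be closed); the
earlier frames stmt-10050/13914/14078 are record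
lines (the rev-7 frame proof `assemblyR_frame_proof` no longer elaborates against the re-typed
summit). W is deliberately outside the frame (D-0027: `closes` is what decides; W is a mechanism
item).

Rationale: WHY THIS LINE. Mechanism (card channels-of-energy-photon-sphere): transplant the
Duyckaerts–Kenig–Merle exterior channel-of-energy
inequality (doi:10.4310/cjm.2013.v1.n1.a3; flat identity and kernel: doi:10.1016/j.aim.2015.08.014,
doi:10.4171/rmi/1399, arXiv:2109.08434;
potentials: doi:10.1016/j.aim.2023.109337; two-ended trapped geometry: arXiv:1609.08477) to the
black-hole exterior, with the horizon as second
channel end and the ball centred on the photon sphere, so that trapping (Sbierski2015) is met only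
through the POSITION and — after the 2026-08-16
repair — the logarithmic SIZE of the excised ball: a LOWER bound on radiated energy where the
black-hole literature has upper bounds
(DafermosRodnianskiShlapentokhrothman2014, GiorgiKlainermanSzeftel2022) or qualitative unique
continuation from infinity (arXiv:1312.1989).
Imported area: dispersive PDE / soliton-resolution technology (channels, rigidity of
compact-trajectory solutions, no-return), used for LARGE
data; the rigidity step leans on stationary ⇒ Kerr (AlexakisIonescuKlainerman2009,
IonescuKlainerman2012). What the repair learned and keeps on
the ledger as negative knowledge (negatives index, stmt-10045): at a FIXED ball no ℓ-uniform
constant exists — horizon-side rest packets lag null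
rays by Λ = 4M ln 2 and the near end of K1 is a MASSIVE Klein–Gordon channel on a Rindler diamond
with m·X_e ≍ 1.82 ℓ e^{−ρ/4M} (five seats,
Lean refutation p75070); the repaired K1R puts the near edge where the mode is redshifted below its
Compton scale (ρ ≥ 4M ln ℓ + O(M)) and the
far edge beyond the compact lost layer (ρ ≳ 2M ln ℓ by two independent state counts), i.e. exactly
the declared pivot ρ₀(ℓ) = O(M log ℓ).

RANKED CRUXES. #2 UniformPhotonSphereChannelsR (crux) — K1R, the log-ball channel inequality: ∀ M >
0 ∃ ρ₀(M) ≥ 0, C(M) ≥ 0, c(M) > 0 such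
that for every tortoise radius function (IsTortoiseRadius M r x_c), every s ≤ 2, ℓ ≥ s, every ρ ≥ ρ₀
+ C·log(ℓ+1):
ChannelInequality (linePotential M s ℓ r) x_c ρ c, i.e. c · inf_{p ∈ P(ρ)} E[ψ − p; {|x − x_c| > ρ},
t = 0] ≤ liminf_{t→+∞} E[ψ; cone_t] +
liminf_{t→−∞} E[ψ; cone_t] for every global C² solution ψ (vocabulary
Literature.Geometry.Lorentzian.ReggeWheeler, defeq to the inlined lets
of K1). [difficulty: XL] (why it might fail: the FAR side — absorbing edge-hugging tangential rest
packets into the t-polynomial kernel is an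
ill-conditioned flat identity; the M ln x/x tail at x_f ~ C ln ℓ may break it for every C, leaving
only x_f ≳ ℓ^a or per-mode channels.)
[arXiv:2109.08434, doi:10.1016/j.aim.2015.08.014, doi:10.4171/rmi/1399,
doi:10.1016/j.aim.2023.109337, arXiv:1609.08477, Sbierski2015]
#3 ChannelsResolveTameDevelopmentsR (crux) — K2R: UniformPhotonSphereChannelsR ⇒ for every
3-manifold Σ, every admissible datum D, every MGHD 𝒟
of D with complete 𝓘⁺ such that (i) NO EXTREMAL REMNANT (no late-time chart from a boosted extremal
Kerr exterior along which the C² deviation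
tends to 0 on every near-zone slab) and (ii) BOUNDED GEOMETRY of the outer region J⁺(Σ) ∩ ⋃
I⁻(future-complete normalised null rays) (some
r₀ > 0, Λ: every point centres a smooth open-embedded coordinate ball of radius r₀ with sup_{C³}|Ψ*g
− η| ≤ Λ, sup_{C⁰}|Ψ*g − η| ≤ 1/2) —
there are O and an honest 2-decomposition d with O = exteriorOf 𝒟 d.charted, RaysStayInClosure 𝒟 O
(every future-complete normalised null ray
from Σ stays in closure O), HasExhaustiveCharts d (honest radii Rᵢ → ∞, Rᵢ ≥ max(r₊,0)+1) and
IsFutureOriented d — the T2 consequent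
(rev 15, stmt-17430; hypotheses unchanged; the rev-14 body stmt-14075 is its corollary, so negative
lemmas transfer). [deps: UniformPhotonSphereChannelsR]
[difficulty: open-problem] (why it might fail: supercritical — tameness gives C² compactness but no
profile decomposition modulo boosts; rigidity
needs non-radiating ⇒ Kerr without analyticity, arXiv:1504.04592 reaches only near i⁰; an AF vacuum
breather with complete 𝓘±, bounded geometry
and zero channel energy kills it; the log-ball costs angular regularity in the nonlinear far-field
comparison; T2 INTERIOR EXPOSURE: the
ray-closure clause sees every future-complete ray from Σ, so on a 3-manifold with a hidden summand,
X = ℝ³ # ℍ³/Γ (CIP gluing,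
arXiv:gr-qc/0403066), a complete ray in an expanding bag (Andersson–Moncrief, arXiv:gr-qc/0303045)
lies outside closure O while (i)–(ii)
plausibly hold — fatal for a ∀-data claim unless the summit clause is restricted to rays escaping
through the end.) [doi:10.4310/cjm.2013.v1.n1.a3,
arXiv:1312.1989, arXiv:1504.04592, AlexakisIonescuKlainerman2009, IonescuKlainerman2012,
DafermosLuk2017, GiorgiKlainermanSzeftel2022,
arXiv:gr-qc/0403066, arXiv:gr-qc/0303045]
#4 TameCensorship (crux) — the complement the mechanism does not touch, as ONE
TAME-Christodoulou-generic property (rev 15, stmt-17431: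
`IsTameChristodoulouGeneric`, tame codimension ≥ 1 in admissibleVacuumData Σ, curve form on one
fixed end; the rev-14 topology-free body
stmt-10047 is its corollary): the datum has an MGHD, and every MGHD has complete 𝓘⁺, no extremal
remnant and bounded geometry of its
outer region — verbatim the hypotheses (i)–(ii) of K2R. [difficulty: open-problem] (why it might
fail: contains weak cosmic censorship; bundles
four generic properties into ONE tame-curve-generic statement (genericity is not closed under ∧); no
tame injective immersed admissible
family through any datum exists in-tree yet (re-type REPORT Q5); extremal formation (KehleUnger2025,
arXiv:2402.10190) must have positive
TAME codimension; a generic exterior with ever finer late-time structure breaks tameness.)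
[Christodoulou1999,
DafermosLuk2017, KehleUnger2025, arXiv:2402.10190, RodnianskiShlapentokhRothman2023]
#5 WindowedShellChannels (crux) — W, route choice 2026-08-16: ∀ M > 0 ∀ ρ > 0 ∃ h(M,ρ) ≥ 0, c(M,ρ) >
0 such that for every
tortoise radius function, every s ≤ 2, ℓ ≥ s and every global C² RW solution ψ with
CauchyDataSupportedOn ψ {ρ < |x − x_c|}:
c · totalEnergy ψ 0 ≤ channelEnergy (linePotential M s ℓ r) x_c (ρ − h) ψ atTop + channelEnergy … (ρ
− h) ψ atBot, i.e.
lost⁺ + lost⁻ ≤ (2 − c)·E for data supported off the shell — lagged windows (h > κ⁻¹ln2 = 4M ln 2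
necessary; periapsis lag Λ(r_edge)
sufficient in geometric optics: u_∞/M = 20.1, 6.28, 2.64, 0.37, −1.69, −10.3 at r₀/M = 3.05, 4, 6,
10, 20, 1000), all data charged,
no kernel, no uniformity in ρ. Not a hypothesis of `closes`: second linear mechanism item
(no-parking law off the photon shell; fallback
input for K2R). [difficulty: XL] (why it might fail: wave corrections to the midpoint law at m·X_e ~
1, or low-frequency sub-barrier data
on the outer slope radiating late in both directions, could make h or 1/c grow with ℓ.)
[arXiv:2109.08434, KenigEtAl2015,
DuyckaertsKenigMerle2013, Sbierski2015, DafermosRodnianski2008, BirrellDavies1982, arXiv:1609.08477]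
#5 FixedModeChannels (support) — K1R per (M, s, ℓ) (ρ₀, c may depend on the mode); NEAR half landed
(Theorems.nearHalfLineChannels, p73389:
recessive static mode + Hardy + d'Alembert + Duhamel), FAR half planned via the elementary
inverse-square intertwining (prover seat 2, FAR-plan).
First prover rung; K1R is its uniform-constant/log-ball version (K1R ⇒ FixedModeChannels,
Sketch.lean). [difficulty: L]
Record lines of the file (dropped, not items): UniformPhotonSphereChannels (stmt-10045, REFUTED by
Theorems.not_UniformPhotonSphereChannels — negatives index; dropped rev 7),
ChannelsResolveTameDevelopments (stmt-10046, K1 → N, ex falso;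
dropped rev 7, superseded by K2R), the frames stmt-10050/13914/14078 (proved against earlier
typings; replaced by stmt-17432 = (K1R ∧ K2R ∧ K3) → FSC over the T2
restatements, open bookkeeping frame closable by
Theorems.PhotonSphereChannels.assemblyT2_frame_proof), BlindnessInsidePhotonSphere (support, proved,
dropped rev 6 for render reasons).

TWO-LAYER PLAN. Foreseen glued splits (filed only when a crux closes or in tenure):
UniformPhotonSphereChannelsR ⇐ NearLogEdgeChannels (near
half-line cone {x < x_c − ρ − |t|}: massless-limit Rindler-diamond identity with m·X_e ≤ 1.82
ℓ^{1−C/4M} → 0, kernel = span(u_hor); the landed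
nearHalfLineChannels is its per-mode form) → FarLogEdgeChannels (one-ended far cone with edge x_c +
ρ₀ + C log(ℓ+1), kernel = the ⌊(2ℓ+5)/4⌋ +
⌊(2ℓ+3)/4⌋ finite-energy t-polynomial towers; THE open half) → K1R (domain of dependence decouples
the two ends). ChannelsResolveTameDevelopmentsR
⇐ KerrTeukolskyChannels (K1R on sub-extremal Kerr for the Teukolsky/Regge–Wheeler system of DHR/GKS,
horizon flux of the Hawking field, ball ⊇
radial range of trapped null geodesics widened by C log ℓ) → NonlinearPerturbativeChannels (far
region: news energy on u < u_S plus past exterior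
energy ≥ c‖π⊥(data − Kerr)‖² − Cε³ per dyadic angular band; needs a news-flux definition over
CauchyDevelopment) → ChannelRigidity (a tame vacuum
development, complete both ways, with zero two-sided channel energy outside every admissible
log-ball is a Kerr exterior; the crux chain on the
old K2 already produced three rigidity-first lines — tame-hull-exact-rigidity-only,
limit-bifurcation-sphere-hawking-collar, secular-modes — that
transfer verbatim to K2R) → K2R. TameCensorship ⇐ WCC (repaired carrier) → generic third law →
generic tameness.

KILL CRITERIA. UniformPhotonSphereChannelsR refuted on the FAR side (c(ℓ) → 0 at ρ = ρ₀ + C log(ℓ+1)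
for EVERY C, by far-side wave numerics
with exact kernel projection or a tangential quasimode family orthogonal to the towers) ⇒ close
`refuted:UniformPhotonSphereChannelsR`; no third
restatement inside this route — a polynomial ball x_f ≳ ℓ^a or frequency-localised (angular
Littlewood–Paley) channels with horizon-FLUX near
ends is a NEW route, to be carded with the far-side data. K1R refuted on the NEAR side despite C
free ⇒ the Rindler-diamond reading is wrong ⇒
close refuted. FixedModeChannels refuted ⇒ the whole line is dead. ChannelsResolveTameDevelopmentsR
refuted by an AF vacuum non-Kerr end-state
with bounded geometry (breather/geon/hairy vacuum black hole) ⇒ close refuted; that witness is major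
negative knowledge for the summit.
TameCensorship refuted ⇒ the summit statement itself is in doubt (report to operator); the route
closes refuted:TameCensorship. Either
nonlinear crux refuted THROUGH THE T2 RAY-CLOSURE CLAUSE by hidden-topology (bag) data ⇒ report to
operator first: that witness bears on
clause (C) of the summit (interior-sensitive), not on the channel mechanism — repair = the
operator's restriction of (C), then restate. FSC proved
elsewhere moots it. WindowedShellChannels refuted (a family of data supported off a
FIXED shell with (lost⁺ + lost⁻)/E → 2 for every lag h — e.g. a lag forced to grow with ℓ by wave
corrections to the midpoint law) ⇒
drop W (not load-bearing; `closes` is untouched) and file the witness as the quantitative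
trapping-off-the-shell barrier. Amendment
(route choice 2026-08-16): if K1R dies on its far side while W stands, the tenure planner may
re-feed K2R with W (one restatement,
K2R ↦ W → N) instead of closing — the only exception to 'no third restatement' above.

NOT DECOMPOSED YET. The near/far split of K1R (above); Kerr (a ≠ 0) channels, the nonlinear
perturbative channel inequality, the rigidity theorem
and the compactness/no-return step inside K2R (layer-2 children; two need a news-flux definition
over CauchyDevelopment); the values of ρ₀(M) and
C(M) (expected C = 4M = 1/κ near, 2M far); Zerilli/even parity (Chandrasekhar transformation) — RW
odd parity + s = 0,1 are typed; the exact
non-radiative kernel census per (s, ℓ) — only its t-polynomial form is used (near side: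
finite-energy kernel = span(u_hor), LANDED as
KernelCensus.static_of_finite_energy); the split of TameCensorship into WCC / third law / tameness.
W's split (near: windowed
horizon flux for Klein–Gordon on the Rindler wedge, uniform in the mass = exact
exponential-potential model, every worldline from X < X_e
meets U = 0 at V ≤ 2X₁ or V = 0 at |U| ≤ 2X₁; far: periapsis-lag bound + semiclassical transport +
fixed-ℓ compactness; glue by domain of
dependence), its sharpness rung h ≥ 4M ln 2, and the exact dependence h(ρ), c(ρ) as ρ → 0.

CHEAPEST FALSIFIER. FAR-side wave numerics (the near side is settled by the Rindler identity): s =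
2, M = 1, one-ended far cone with edge
x_f = x_c + ρ, ρ ∈ {6, 6 + 4 log(ℓ+1)}, ℓ ∈ {16, 64, 256, 1024}; tangential rest packets (Gaussian,
(g,0) and (0,g)) centred at x_f + d,
d ∈ [r_f/ℓ, r_f]; EXACT projection onto the finite-energy t-polynomial far kernel (dimension
⌊(2ℓ+5)/4⌋ + ⌊(2ℓ+3)/4⌋, towers by ODE shooting from
the recessive solution x^{−ℓ}; the projection is ill-conditioned — use ≥ 50-digit arithmetic or
orthogonalise the towers in the energy inner
product first); report q = (E⁺_far + E⁻_far)/dist². K1R dies if inf_d q → 0 along ℓ at ρ = 6 + 4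
log(ℓ+1) (and the run at ρ = 6 fixes whether
2M ln ℓ, 4M ln ℓ or no log suffices on the far side). ≈ 1–2 CPU-h as a kit job; flat control (V =
ℓ(ℓ+1)/x²) must return q = 1.000 (Côte–Laurent).
Not run here (repair seat; no kit in this unit). Second cheapest: the literature check whether an AF
vacuum time-periodic non-stationary
spacetime with complete 𝓘± is excluded only under analyticity/near infinity (arXiv:1504.04592,
Bičák–Scholtz–Tod) — bounds how much of K2R is
rigidity folklore. For W (same solver, no kernel projection needed): data (0,g) and (g,0) supported
in
[x_c + ρ, x_c + ρ + w] and [x_c − ρ − w, x_c − ρ], ρ ∈ {1, 3, 6}M, w ∈ {0.5, 2}M, ℓ ∈ {8, …, 1024},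
plus inward/outward-boosted packets and
far periapsis beams at r₀ ∈ {4, 6, 10}M; report (lost⁺ + lost⁻)/E as a function of the lag h. W dies
if for every h the supremum over
packets tends to 2 along ℓ; prediction: ≤ 2 − c once h > max(Λ_near(ρ), Λ_far(ρ)) (Λ_near → 4M ln 2
+ O(e^{−ρ/2M}) on the tail,
Λ_far = Λ(r(x_c + ρ)), e.g. 10.3M at r_edge = 4M — this seat's table calc/tangent_lag.py).

NUMBERS. Photon sphere r = 3M, tortoise centre x_c = r*(3M); RW potential peak r_ℓ ↓ 3M (r_2 ≈ 3.28M
for s = 2), V_max ≈ ℓ²/27M²; Lyapunov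
exponent of the photon orbit 1/(3√3 M); surface gravity κ = 1/4M. Refutation constants: horizon-side
lag Λ = 4M ln 2 = 2.77M exactly on the
exponential tail (Λ(x_e)/M = 11.5, 8.33, 5.61, 4.37, 3.71, 3.11, 2.89, 2.82 at ρ/M = .5, 1, 2, 3, 4,
6, 8, 10); Kruskal mass m² =
ℓ(ℓ+1)e^{1/2}/8M², near edge X_e = 4M e^{−ρ/4M}, m·X_e = 1.82 ℓ e^{−ρ/4M}; fixed ball ρ = 6M: q =
1.000/.999/.984/.933/.710/.236/9.4e-3/1.9e-4
for ℓ = 4…512 (seat 1), 0.727/…/0.00119 for ℓ = 4…256 (cdisprove); window ρ = 2M ln ℓ: q =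
.480/.381/.127/.0177/.0029 for ℓ = 32…8192 (still
collapsing: m X_e ∝ ℓ^{1/2}); threshold: collapse iff ω₀M ≳ 2; control V ≡ 0: q = 0.9992–0.99998.
Far side: lost layer compact (rays turning at
r₀ ≳ 15M e^{ρ/2M} outrun the edge), surplus over the kernel count (ν_S − 1)ℓ with ν_S − 1 = 2.5e-2 …
1.7e-5 at r_e = 4…15M (~e^{−r_e/2M});
flat: ν = 1 to 2e-6; kernel dimension per ℓ: ⌊(2ℓ+5)/4⌋ position + ⌊(2ℓ+3)/4⌋ velocity towers. Card
numerics (s = 2, M = 1, ℓ ≤ 8, ρ = 6):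
c ≈ 1.00/0.975, 1.00/0.885, 0.925/0.938 — the pre-asymptotic regime ω_edge M ≲ 1. Periapsis
(tangent) null rays, M = 1, edge-independent: Λ(r₀)/M = 21.8, 10.3, 10.0, 13.1, 22.7, 102.4 and
u_∞ = −r_*(r₀) + Λ = 20.1, 6.28, 2.64, 0.37, −1.69, −5.36 at r₀/M = 3.05, 4, 6, 10, 20, 100 (Λ − r₀
→ ≈ 2.2–2.4M). Items after the route
choice: K1R (2, CLOSED 2026-08-16T17:53Z by Theorems.uniformPhotonSphereChannelsR_proof), K2R (3,
stmt-17430), K3 (4, stmt-17431), W (5)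
cruxes, FixedModeChannels support, Assembly stmt-17432 frame; record lines K1/old K2/old
frames/Blindness.

DEFINITION REQUESTS. (1) NewsFlux / radiation-energy through portions {u < u₀} of 𝓘⁺ and {v < v₀} of
𝓗⁺ for a `CauchyDevelopment` (the
prelude's `BondiFoliation` is over the uninhabited `Development`): needed to type
NonlinearPerturbativeChannels and ChannelRigidity (layer 2).
(2) FULFILLED: the 1+1 Regge–Wheeler channel vocabulary now lives in
Literature.Geometry.Lorentzian.ReggeWheeler{Tortoise,Channels}
(IsTortoiseRadius, linePotential, exteriorEnergy, channelEnergy, rwKernel, kernelDeficit,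
ChannelInequality, farChannelEnergy); K1R is stated
over it. (3) Optional: `farKernel`/`farDeficit` (one-ended versions of rwKernel/kernelDeficit) in
the same file, to type FarLogEdgeChannels.

Novelty: Searches (2026-08-15, this seat): `lit frontier FinalStateConjecture --since 2020` (30 rows:
trapped-surface formation,
Kerr–de Sitter stability, smooth-null-infinity series — nothing on exterior-energy lower bounds);
`lit bridges FinalStateConjecture
--cross any` (30 rows, surveys/SCC; none joins DKM channels to black holes); `lit galaxy search
"channels of energy" --star all`
(17 rows, noise except C. Laurent's HDR); zbMATH "channels of energy black hole" (15, all
hep-th/quantum-information noise),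
"channels of energy wave equation potential" (16, noise), "Kehle Unger extremal black hole
formation" (3: arXiv:2402.10190,
arXiv:2211.15742, arXiv:2411.17938); Crossref "channels of energy soliton resolution black hole
Schwarzschild exterior" (10: the
one mathematical neighbour is doi:10.1016/j.aim.2024.109785, Masaood's scattering theory for
linearised gravity on Schwarzschild —
a unitary FULL radiation-field map, no truncation/coercivity); local hybrid over 5.26 M held chunks
"exterior channel energy
estimates … odd dimensions" (10: only book:lax1967-scattering-theory pp. 101–102, the Lax–Phillips
translation representation =
the flat, sharp-Huygens ancestor of the channel identity); searchd/OpenAlex/arXiv were rate-limited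
or unavailable (rc 75/429) for
the rest, so the card's battery also stands: zbMATH "channels of energy" (16), "channel of energy"
wave (17), "nonradiative
solutions" (3), "soliton resolution"+"general relativity" (4), Crossref "channels of energy wave
equat  [refs: 10.1016/j.aim.2024.109785, 10.1016/j.aim.2015.08.028, 10.4171/rmi/1399, 10.1016/j.aim.2015.08.014, 10.1016/j.aim.2023.109337, 10.1002/cpa.20281, 10.1088/0264-9381/30/6/065001, 2402.10190, 2211.15742, 2411.17938, 1609.08477, 1312.1989, 1412.8379, 2109.08434, doi:10.1016/j.aim.2024.109785, book:lax1967-scattering-theory, doi:10.1016/j.aim.2015.08.028, doi:10.4171/rmi/1399, doi:10.1016/j.aim.2015.08.]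

Barriers (technique_class: channels-of-energy, energy-estimates, rigidity): - technique_class: channels-of-energy, energy-estimates, rigidity
- Literature.Barriers.FinalStateConjecture.SbierskiTrappingObstruction: evaded by shape — the ball
B_ρ ⊇ photon region is excised and projected out; beams on the trapped set never enter the exterior
cone; beams aimed at it from outside are caught by the backward channel; the derivative loss of
local-energy decay at trapping (SbierskiKerrTrappingLED) is an upper-bound phenomenon invisible to a
statement that asks no rate; the barrier reappears as the PROVABLE support item
BlindnessInsidePhotonSphere (𝓘-only channels are blind inside 3M). For W: beams on or asymptotic to
the trapped set are excluded by SUPPORT (data vanish on the shell) and every other null geodesic is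
caught in one time direction within the lag h(ρ) — W is the barrier's quantitative converse.
- Literature.Barriers.FinalStateConjecture.SbierskiTrappingObstructionAdmissible: admissible-class
form (loss-free uniform LED fails for admissible waves with data in any ball meeting the exterior:
photon orbits AND the critical spirals asymptotic to them, caveat (vii)); evaded as above and more
sharply — no item asks a rate or a loss-free LED bound; K1R projects the log-ball out; W charges
only data supported OFF the shell and asks prompt radiation in ONE time direction: a critical spiral
launched off the shell is future-trapped but escapes promptly in the past (lag ≤ the periapsis lag
at the shell edge); only the photon orbits, inside the shell, are two-s

History (route lifecycle, newest last):
- 2026-08-15T22:52:39Z · rev 4: restated Assembly (stmt-FinalStateConjecture-10050 proved) — route-repair (glue-native-fail): the materialise failure (7× `has already been declared`) is an IMPORT CYCLE, not a proof error — after the Assembly item stmt-F (planner-rglue-FinalStateConjecture-PhotonSphe-22ed2a8f-0)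
- 2026-08-16T00:49:56Z · rev 6: dropped BlindnessInsidePhotonSphere — route-repair (glue; render import cycle, 3rd episode): `closes` is unchanged (rev-4 text, native-certified: UniformPhotonSphereChannels → ChannelsResolveTameDev (planner-rbadge-FinalStateConjecture-PhotonSphe-22ed2a8f-0)
- 2026-08-16T02:11:05Z · BROKEN — UniformPhotonSphereChannels (stmt-FinalStateConjecture-10045, crux) refuted by Summit.FinalStateConjecture.FinalStateConjecture.Theorems.not_UniformPhotonSphereChannels (prover-FinalStateConjecture-route-FinalStateConjecture-Photo)
- 2026-08-16T02:38:50Z · rev 7: restated Assembly (stmt-FinalStateConjecture-13914 proved) — repair step 2 (clear BROKEN): drop the refuted K1 UniformPhotonSphereChannels (stmt-10045, refuted by Theorems.not_UniformPhotonSphereChannels @939f8058272a; su (planner-rfix-FinalStateConjecture-PhotonSphe-22ed2a8f-0)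
- 2026-08-16T02:38:50Z · rev 7: dropped UniformPhotonSphereChannels, ChannelsResolveTameDevelopments — repair step 2 (clear BROKEN): drop the refuted K1 UniformPhotonSphereChannels (stmt-10045, refuted by Theorems.not_UniformPhotonSphereChannels @939f8058272a; su (planner-rfix-FinalStateConjecture-PhotonSphe-22ed2a8f-0)
- 2026-08-16T02:38:50Z · REPAIRED (restate Assembly; drop UniformPhotonSphereChannels, ChannelsResolveTameDevelopments) — back to open: repair step 2 (clear BROKEN): drop the refuted K1 UniformPhotonSphereChannels (stmt-10045, refuted by Theorems.not_UniformPhotonSphereChannels @939f8058272a; su (planner-rfix-FinalStateConjecture-PhotonSphe-22ed2a8f-0)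
- 2026-08-16T23:19:00Z · rev 15: restated ChannelsResolveTameDevelopmentsR (stmt-FinalStateConjecture-14075), TameCensorship (stmt-FinalStateConjecture-10047), Assembly (stmt-FinalStateConjecture-14078 proved) — route-repair (statement-revised p126844, T2): K2R ChannelsResolveTameDevelopmentsR restated in place with the T2 consequent (… ∧ Rays (planner-rrepair-FinalStateConjecture-PhotonSph-4a1b7431-0)
- 2026-08-25T17:29:14Z · DORMANT — reconciler: no traction for 7.9 d (last activity item-evidence-added at 2026-08-17T19:19:28Z); parked, not closed — `ledger route dormant route-FinalStateConjec (operator:999:2302478)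

sub-problem: FinalStateConjecture · status: dormant · opened planner-plancard-FinalStateConjecture-FinalSt-5b18e001-0 2026-08-15T15:03:34Z · rev 16 · ledger route-FinalStateConjecture-PhotonSphereChannels
GENERATED by the gate from the ledger (D-0016/17). Provers cite these decls: `theorem foo : Summit.FinalStateConjecture.FinalStateConjecture.Theses.PhotonSphereChannels.<Decl> := …` in Summits/FinalStateConjecture/FinalStateConjecture/Theorems/<Name>.lean.
-/

namespace Summit.FinalStateConjecture.FinalStateConjecture.Theses.PhotonSphereChannels

open scoped BigOperators Topology Manifold Classical MeasureTheory ProbabilityTheory Matrix InnerProductSpace ComplexConjugate ContinuousMap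
open Filter Set Function TopologicalSpace MeasureTheory

attribute [summit_statement] _root_.FinalStateConjecture

/-- item stmt-FinalStateConjecture-14074 · crux · rank 2 · closed · proved by Summit.FinalStateConjecture.FinalStateConjecture.Theorems.uniformPhotonSphereChannelsR_proof (prover) · by planner
why it might fail: Far side: absorbing edge-hugging tangential (rest) high-ℓ packets into the t-polynomial kernel is an ill-conditioned flat identity (Müntz coefficients ~e^{c√ℓ}); the M ln x/x tail at x_f ~ C ln ℓ may break it for EVERY C (phase error 4Mℓ ln x_f/x_f → ∞): then only x_f ≳ ℓ^a or per-mode survive.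
sources: arXiv:2109.08434, doi:10.1016/j.aim.2015.08.014, doi:10.4171/rmi/1399, doi:10.1016/j.aim.2023.109337, doi:10.4310/cjm.2013.v1.n1.a3, arXiv:1609.08477
[crux] repaired UniformPhotonSphereChannels (K1R; the route's declared pivot, named by every
refuting seat): VERBATIM the two-ended exterior-cone channel-of-energy inequality for the
Regge–Wheeler family (s ≤ 2, ℓ ≥ s) on Schwarzschild — kernel P(ρ) = t-polynomial solutions on the
exterior cone, constant c = c(M) > 0 UNIFORM in s, ℓ and ρ — except that the excised ball centred at
the photon sphere may grow logarithmically with the angular number: the inequality is claimed for ρ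
≥ ρ₀(M) + C(M)·log(ℓ+1). Stated over the landed vocabulary
Literature.Geometry.Lorentzian.ReggeWheeler.{IsTortoiseRadius, ChannelInequality, linePotential}
(defeq to the inlined lets of K1/FixedModeChannels: `exact` bridges both ways in the planner's
Sketch.lean, rc 0). Why the refuting witnesses miss it: the frozen/rest packets flush below the near
edge (not_UniformPhotonSphereChannels, p75070; 4M ln 2 lag law, 5 seats' numerics) need local mass ×
Kruskal size m·X_e ≍ 1.82 ℓ e^{−ρ/4M} ≫ 1; at ρ ≥ 4M ln ℓ + 2.4M the near diamond is an effectively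
MASSLESS Rindler wedge where the two-ended identity holds (c → 1 as m X_e → 0; threshold confirmed:
q collapses iff ω₀M ≳ 2, and at ρ = 2M ln ℓ it still collapses, -/
@[route_item "route-FinalStateConjecture-PhotonSphereChannels", crux]
def UniformPhotonSphereChannelsR : Prop :=
  ∀ M : ℝ, 0 < M → ∃ ρ₀ : ℝ, 0 ≤ ρ₀ ∧ ∃ C : ℝ, 0 ≤ C ∧ ∃ c : ℝ, 0 < c ∧ ∀ (r : ℝ → ℝ) (xc : ℝ), Literature.Geometry.Lorentzian.ReggeWheeler.IsTortoiseRadius M r xc → ∀ (s ℓ : ℕ), s ≤ 2 → s ≤ ℓ → ∀ ρ : ℝ, ρ₀ + C * Real.log ((ℓ : ℝ) + 1) ≤ ρ → Literature.Geometry.Lorentzian.ReggeWheeler.ChannelInequality (Literature.Geometry.Lorentzian.ReggeWheeler.linePotential M s ℓ r) xc ρ c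

/-- `UniformPhotonSphereChannelsR` holds: proved by `Summit.FinalStateConjecture.FinalStateConjecture.Theorems.uniformPhotonSphereChannelsR_proof`. -/
theorem UniformPhotonSphereChannelsR_holds : UniformPhotonSphereChannelsR := _root_.Summit.FinalStateConjecture.FinalStateConjecture.Theorems.uniformPhotonSphereChannelsR_proof

-- earlier ChannelsResolveTameDevelopmentsR (stmt-FinalStateConjecture-14075, replaced 2026-08-16T23:19:00Z -> stmt-FinalStateConjecture-17430): retired by None — UniformPhotonSphereChannelsR → ∀ (X : Type) [TopologicalSpace X] [ChartedSpace Literature.Geometry.Lorentzian.E3 X] [IsManifold (modelWithCornersSelf ℝ Literature.Geometry.Lorentzian.E3) ((⊤ : ℕ∞) : WithTop ℕ∞) X] [T2Space X] [SecondCountab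
/-- item stmt-FinalStateConjecture-17430 · crux · rank 3 · open · by planner
why it might fail: Supercritical (no profile decomposition mod boosts); rigidity needs non-radiating ⇒ Kerr beyond arXiv:1504.04592; an AF vacuum breather kills it. T2 interior exposure: on X = ℝ³ # ℍ³/Γ (CIP gluing) a future-complete ray in a hidden expanding bag lies outside closure O — fatal for a ∀-data claim.
sources: doi:10.4310/cjm.2013.v1.n1.a3, arXiv:1312.1989, arXiv:1504.04592, AlexakisIonescuKlainerman2009, IonescuKlainerman2012, DafermosLuk2017
[crux] K2R re-typed for the T2 summit statement (p126844, 2026-08-16T21:19Z): hypotheses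
byte-identical to rev 7/14 (UniformPhotonSphereChannelsR → for every Σ, admissible D, maximal
development 𝒟 with complete 𝓘⁺, (i) no extremal-Kerr late chart with C²-deviation → 0, (ii)
C³-bounded geometry of the outer region J⁺(Σ) ∩ I⁻(future-complete normalised null rays from Σ) at a
uniform scale r₀ with C⁰-deviation ≤ 1/2); consequent now the FULL T2 conclusion ∃ O d, O =
exteriorOf 𝒟 d.charted ∧ RaysStayInClosure 𝒟 O (every future-complete normalised null ray from Σ
stays in closure O) ∧ HasExhaustiveCharts d (honest radii: Rᵢ → ∞, Rᵢ ≥ max(r₊,0)+1, near-zone C²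
convergence out to Rᵢ, causal exhaustion of O by the certified slabs) ∧ IsFutureOriented d
(orthochronous motions; transported Kerr timeVector / ∂₀ eventually future-directed on the certified
slabs). Sub-extremality of the holes is still derived in `closes` from |aᵢ| ≤ Mᵢ and (i). The three
new outputs are properties of the decomposition the DKM-type resolution builds, so they live in this
crux, not in K3. Successor of stmt-FinalStateConjecture-14075: its evidence (CruxAttack anatomy,
TameHull/KerrDev supports, Negative read-backs) -/
@[route_item "route-FinalStateConjecture-PhotonSphereChannels", crux]
def ChannelsResolveTameDevelopmentsR : Prop :=
  UniformPhotonSphereChannelsR → ∀ (X : Type) [TopologicalSpace X] [ChartedSpace Literature.Geometry.Lorentzian.E3 X] [IsManifold (modelWithCornersSelf ℝ Literature.Geometry.Lorentzian.E3) ((⊤ : ℕ∞) : WithTop ℕ∞) X] [T2Space X] [SecondCountableTopology X] [ConnectedSpace X], ∀ D ∈ Literature.Geometry.Lorentzian.admissibleVacuumData X, ∀ 𝒟 : Literature.Geometry.Lorentzian.VacuumCauchyDevelopment D, 𝒟.IsMaximal → _root_.Summit.FinalStateConjecture.HasCompleteNullInfinity 𝒟.toCauchyDevelopment → ((∀ (Λ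 : Literature.Geometry.Lorentzian.lorentzGroup) (c : Literature.Geometry.Lorentzian.E4) (M a : ℝ), Literature.Geometry.Lorentzian.Kerr.IsExtremal M a → ¬ ∃ (τ₀ : ℝ) (Ψ : (Literature.Geometry.Lorentzian.boostedKerrBackground Λ c M a).domain → 𝒟.carrier), 𝒟.toSpacetime.IsLateChart (Literature.Geometry.Lorentzian.boostedKerrBackground Λ c M a) Set.univ τ₀ Ψ ∧ ∀ R : ℝ, Filter.Tendsto (fun τ => 𝒟.toSpacetime.truncDeviationCk (Literature.Geometry.Lorentzian.boostedKerrBackground Λ c M a) Ψ 2 R τ) Filter.atTop (nhds 0)) ∧ ∀ [𝒟.metric.HasLeviCivita], let outer : Set 𝒟.carrier := 𝒟.metric.causalFuture 𝒟.timeOrientation (Set.range 𝒟.embed) ∩ {q | ∃ (p : X) (γ : ℝ → 𝒟.carrier) (dom : Set ℝ), 𝒟.metric.IsNormalisedNullRayFrom 𝒟.timeOrientation 𝒟.embed 𝒟.normal p γ dom ∧ ¬ BddAbove dom ∧ q ∈ 𝒟.metric.chronologicalPast 𝒟.timeOrientation (γ '' (dom ∩ Set.Ici 0))}; ∃ r₀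 : ℝ, 0 < r₀ ∧ ∃ Λ : NNReal, ∀ q ∈ outer, let U : TopologicalSpace.Opens Literature.Geometry.Lorentzian.E4 := ⟨Metric.ball (0 : Literature.Geometry.Lorentzian.E4) r₀, Metric.isOpen_ball⟩; ∃ Ψ : U → 𝒟.carrier, 𝒟.toSpacetime.IsLateChart (Literature.Geometry.Lorentzian.Minkowski.backgroundOn U) Set.univ (-r₀) Ψ ∧ (∃ x : U, (x : Literature.Geometry.Lorentzian.E4) = 0 ∧ Ψ x = q) ∧ Literature.Geometry.Lorentzian.supCkENorm (U : Set Literature.Geometry.Lorentzian.E4) 3 (𝒟.toSpacetime.deviationExtend (Literature.Geometry.Lorentzian.Minkowski.backgroundOn U) Ψ) ≤ (Λ : ENNReal) ∧ Literature.Geometry.Lorentzian.supCkENorm (U : Set Literature.Geometry.Lorentzian.E4) 0 (𝒟.toSpacetime.deviationExtend (Literature.Geometry.Lorentzian.Minkowski.backgroundOn U) Ψ) ≤ 1 / 2) → ∃ (O : Set 𝒟.carrier) (d : Literature.Geometry.Lorentzian.FinalStateDecomposition 𝒟.toSpacetime O 2), O = _root_.Summit.FinalStateConjecture.exteriorOf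 𝒟.toCauchyDevelopment d.charted ∧ _root_.Summit.FinalStateConjecture.RaysStayInClosure 𝒟.toCauchyDevelopment O ∧ _root_.Summit.FinalStateConjecture.HasExhaustiveCharts d ∧ _root_.Summit.FinalStateConjecture.IsFutureOriented d

-- earlier TameCensorship (stmt-FinalStateConjecture-10047, replaced 2026-08-16T23:19:00Z -> stmt-FinalStateConjecture-17431): retired by None — ∀ (X : Type) [TopologicalSpace X] [ChartedSpace Literature.Geometry.Lorentzian.E3 X] [IsManifold (modelWithCornersSelf ℝ Literature.Geometry.Lorentzian.E3) ((⊤ : ℕ∞) : WithTop ℕ∞) X] [T2Space X] [SecondCountableTopology X] [ConnectedSpace X], Literature.Geom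
/-- item stmt-FinalStateConjecture-17431 · crux · rank 4 · open · by planner
why it might fail: Contains weak cosmic censorship; bundles WCC, third law and tameness into ONE tame-curve-generic property (not closed under ∧); no tame injective immersed admissible family exists in-tree yet (REPORT Q5); extremal formation (KehleUnger2025) needs positive TAME codimension.
sources: Christodoulou1999, DafermosLuk2017, KehleUnger2025, arXiv:2402.10190, RodnianskiShlapentokhRothman2023
[crux] K3 re-typed for the T2 summit statement (p126844): the SAME bundled property (MGHD exists;
every MGHD has complete 𝓘⁺, no extremal remnant, bounded outer geometry — verbatim hypotheses
(i)–(ii) of ChannelsResolveTameDevelopmentsR) is now TAME-Christodoulou-generic: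
`InitialDataSet.IsTameChristodoulouGeneric (admissibleVacuumData Σ) Q 1`
(Literature.Geometry.Lorentzian.TameGenericity, p117423): through every admissible exceptional datum
passes an injective one-parameter admissible family, jointly smooth, tame on ONE fixed AF end (sole
end; DR rates with continuous mass M(c); wDist-continuous at c = 0) and immersed at c = 0, whose
other members satisfy Q. Strictly stronger than the old K3 (tame ⇒ topology-free genericity,
`IsTameChristodoulouGeneric.isChristodoulouGeneric`; planner Sketch.lean `tameCensorshipOld_of`), so
every negative-side lemma on stmt-FinalStateConjecture-10047 transfers by contraposition;
burial-type witness families (exact Kerr outside a receding set, M(c) → ∞) are no longer available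
to PROVE it. Body byte-identical to the third conjunct of
Theorems.PhotonSphereChannels.assemblyT2_frame_proof. -/
@[route_item "route-FinalStateConjecture-PhotonSphereChannels", crux]
def TameCensorship : Prop :=
  ∀ (X : Type) [TopologicalSpace X] [ChartedSpace Literature.Geometry.Lorentzian.E3 X] [IsManifold (modelWithCornersSelf ℝ Literature.Geometry.Lorentzian.E3) ((⊤ : ℕ∞) : WithTop ℕ∞) X] [T2Space X] [SecondCountableTopology X] [ConnectedSpace X], Literature.Geometry.Lorentzian.InitialDataSet.IsTameChristodoulouGeneric (Literature.Geometry.Lorentzian.admissibleVacuumData X) (fun D => (∃ 𝒟 : Literature.Geometry.Lorentzian.VacuumCauchyDevelopment D, 𝒟.IsMaximal) ∧ ∀ 𝒟 : Literature.Geometry.Lorentzian.VacuumCauchyDevelopment D, 𝒟.IsMaximal → _root_.Summit.FinalStateConjecture.HasCompleteNullInfinity 𝒟.toCauchyDevelopment ∧ ((∀ (Λ : Literature.Geometry.Lorentzian.lorentzGroup) (c : Literature.Geometry.Lorentzian.E4) (M a : ℝ), Literature.Geometry.Lorentzian.Kerr.IsExtremal M a → ¬ ∃ (τ₀ : ℝ)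 (Ψ : (Literature.Geometry.Lorentzian.boostedKerrBackground Λ c M a).domain → 𝒟.carrier), 𝒟.toSpacetime.IsLateChart (Literature.Geometry.Lorentzian.boostedKerrBackground Λ c M a) Set.univ τ₀ Ψ ∧ ∀ R : ℝ, Filter.Tendsto (fun τ => 𝒟.toSpacetime.truncDeviationCk (Literature.Geometry.Lorentzian.boostedKerrBackground Λ c M a) Ψ 2 R τ) Filter.atTop (nhds 0)) ∧ ∀ [𝒟.metric.HasLeviCivita], let outer : Set 𝒟.carrier := 𝒟.metric.causalFuture 𝒟.timeOrientation (Set.range 𝒟.embed) ∩ {q | ∃ (p : X) (γ : ℝ → 𝒟.carrier) (dom : Set ℝ), 𝒟.metric.IsNormalisedNullRayFrom 𝒟.timeOrientation 𝒟.embed 𝒟.normal p γ dom ∧ ¬ BddAbove dom ∧ q ∈ 𝒟.metric.chronologicalPast 𝒟.timeOrientation (γ '' (dom ∩ Set.Ici 0))}; ∃ r₀ : ℝ, 0 < r₀ ∧ ∃ Λ : NNReal, ∀ q ∈ outer, let U : TopologicalSpace.Opens Literature.Geometry.Lorentzian.E4 := ⟨Metric.ball (0 : Literature.Geometry.Lorentzian.E4)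 r₀, Metric.isOpen_ball⟩; ∃ Ψ : U → 𝒟.carrier, 𝒟.toSpacetime.IsLateChart (Literature.Geometry.Lorentzian.Minkowski.backgroundOn U) Set.univ (-r₀) Ψ ∧ (∃ x : U, (x : Literature.Geometry.Lorentzian.E4) = 0 ∧ Ψ x = q) ∧ Literature.Geometry.Lorentzian.supCkENorm (U : Set Literature.Geometry.Lorentzian.E4) 3 (𝒟.toSpacetime.deviationExtend (Literature.Geometry.Lorentzian.Minkowski.backgroundOn U) Ψ) ≤ (Λ : ENNReal) ∧ Literature.Geometry.Lorentzian.supCkENorm (U : Set Literature.Geometry.Lorentzian.E4) 0 (𝒟.toSpacetime.deviationExtend (Literature.Geometry.Lorentzian.Minkowski.backgroundOn U) Ψ) ≤ 1 / 2)) 1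

/-- item stmt-FinalStateConjecture-14085 · crux · rank 5 · open · by planner
why it might fail: Wave corrections to the Rindler midpoint law at Compton size m·X_e ~ 1, or low-frequency sub-barrier data on the outer slope radiating late in BOTH time directions, could force h or 1/c to grow with ℓ; only geometric optics and the massless/massive limits are checked.
sources: arXiv:2109.08434, KenigEtAl2015, DuyckaertsKenigMerle2013, Sbierski2015, DafermosRodnianski2008, BirrellDavies1982
[crux] WINDOWED TWO-ENDED PHOTON-SHELL CHANNELS for data supported off the shell (the genuinely
different linear crux filed at the route choice 2026-08-16; hedge to K1R and the route's linear
'no-parking law'): for every M > 0 and every shell half-width ρ > 0 there are a window lag h =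
h(M,ρ) ≥ 0 and c = c(M,ρ) > 0 such that for every tortoise radius function (IsTortoiseRadius M r
x_c), every s ≤ 2, ℓ ≥ s and every global C² Regge–Wheeler solution ψ whose Cauchy data vanish on
the closed shell {|x − x_c| ≤ ρ}: c·E_total(ψ) ≤ liminf_{t→+∞} E[ψ; {|x − x_c| > ρ − h + |t|}] +
liminf_{t→−∞} E[ψ; {|x − x_c| > ρ − h + |t|}] — equivalently lost⁺ + lost⁻ ≤ (2 − c)E: no datum
supported off the photon shell can lose (almost) all its energy behind the light cones from the
LAGGED edges x_c ± (ρ − h) in BOTH time directions, uniformly in s and ℓ ('the photon shell is the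
only two-sided trap', quantitatively). Three changes w.r.t. the refuted K1, each forced by the
refutation analysis: (1) a LAG h instead of sharp cones from the ball edge — horizon-side rest
packets cross 𝓗⁺ at Kruskal V = 2X₁ (midpoint law of the Rindler/Klein–Gordon dictionary,
Cruxes/UniformPhotonSphereChannels/Ideas/rindler-b -/
@[route_item "route-FinalStateConjecture-PhotonSphereChannels"]
def WindowedShellChannels : Prop :=
  ∀ M : ℝ, 0 < M → ∀ ρ : ℝ, 0 < ρ → ∃ h : ℝ, 0 ≤ h ∧ ∃ c : ℝ, 0 < c ∧ ∀ (r : ℝ → ℝ) (xc : ℝ), Literature.Geometry.Lorentzian.ReggeWheeler.IsTortoiseRadius M r xc → ∀ (s ℓ : ℕ), s ≤ 2 → s ≤ ℓ → ∀ ψ : ℝ → ℝ → ℝ, Literature.Geometry.Lorentzian.ReggeWheeler.IsRWSolution M s ℓ r ψ → Literature.Geometry.Lorentzian.ReggeWheeler.CauchyDataSupportedOn ψ {x : ℝ | ρ < |x - xc|} → ENNReal.ofReal c * Literature.Geometry.Lorentzian.ReggeWheeler.totalEnergy (Literature.Geometry.Lorentzian.ReggeWheeler.linePotential M s ℓ r)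 ψ 0 ≤ Literature.Geometry.Lorentzian.ReggeWheeler.channelEnergy (Literature.Geometry.Lorentzian.ReggeWheeler.linePotential M s ℓ r) xc (ρ - h) ψ Filter.atTop + Literature.Geometry.Lorentzian.ReggeWheeler.channelEnergy (Literature.Geometry.Lorentzian.ReggeWheeler.linePotential M s ℓ r) xc (ρ - h) ψ Filter.atBot

/-- item stmt-FinalStateConjecture-10048 · support · rank 5 · closed · proved by Summit.FinalStateConjecture.FinalStateConjecture.Theorems.fixedModeChannels_proof (prover) · by planner
why it might fail: No channel estimate exists for a potential with an inverse-square far end AND an exponentially flat (horizon) end; the true non-radiative space may exceed the t-polynomial solutions (a finite-energy zero-radiation mode on the cone not polynomial in t refutes it).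
sources: doi:10.1016/j.aim.2015.08.014, doi:10.1016/j.aim.2023.109337, doi:10.4171/rmi/1399, doi:10.1007/s12220-020-00591-z
[crux] card item (1): the same two-ended channel inequality with ρ₀ and c allowed to depend on (M,
s, ℓ) — per spherical mode the far equation is the radial free wave equation in dimension 3 + 2ℓ
plus an O(M ℓ² log r / r³) tail and the near end is exponentially flat, so KLLS/CDKM technology
should reach it; the kernel P_ℓ(ρ) (t-polynomial solutions on the cone) is the new identification.
First prover target; UniformPhotonSphereChannels is its uniform version. [difficulty: L] -/
@[route_item "route-FinalStateConjecture-PhotonSphereChannels"]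
def FixedModeChannels : Prop :=
  ∀ M : ℝ, 0 < M → ∀ (s ℓ : ℕ), s ≤ 2 → s ≤ ℓ → ∃ ρ₀ : ℝ, 0 ≤ ρ₀ ∧ ∃ c : ℝ, 0 < c ∧ ∀ (r : ℝ → ℝ) (xc : ℝ), (∀ x, 2 * M < r x) → (∀ x, HasDerivAt r (1 - 2 * M / r x) x) → r xc = 3 * M → ∀ ρ : ℝ, ρ₀ ≤ ρ → ∀ ψ : ℝ → ℝ → ℝ, ContDiff ℝ 2 (Function.uncurry ψ) → let V : ℝ → ℝ := fun x => (1 - 2 * M / r x) * ((ℓ : ℝ) * ((ℓ : ℝ) + 1) / r x ^ 2 + (1 - (s : ℝ) ^ 2) * (2 * M) / r x ^ 3); let e : (ℝ → ℝ → ℝ) → ℝ → ℝ → ℝ := fun φ t x => deriv (fun τ => φ τ x) t ^ 2 + deriv (φ t) x ^ 2 + V x * φ t x ^ 2; let IsSol : (ℝ → ℝ → ℝ) → ℝ × ℝ → Prop := fun φ z => iteratedDeriv 2 (fun τ => φ τ z.2) z.1 - iteratedDeriv 2 (φ z.1) z.2 + V z.2 * φ z.1 z.2 = 0; let Ω : Set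 (ℝ × ℝ) := {z | ρ + |z.1| < |z.2 - xc|}; let P : Set (ℝ → ℝ → ℝ) := {p | ContDiffOn ℝ 2 (Function.uncurry p) Ω ∧ (∀ z ∈ Ω, IsSol p z) ∧ ∃ (N : ℕ) (a : ℕ → ℝ → ℝ), ∀ z ∈ Ω, p z.1 z.2 = ∑ i ∈ Finset.range N, a i z.2 * z.1 ^ i}; let Eext : ℝ → ENNReal := fun t => MeasureTheory.lintegral (MeasureTheory.volume.restrict {x : ℝ | ρ + |t| < |x - xc|}) (fun x => ENNReal.ofReal (e ψ t x)); (∀ z, IsSol ψ z) → ENNReal.ofReal c * (⨅ p ∈ P, MeasureTheory.lintegral (MeasureTheory.volume.restrict {x : ℝ | ρ < |x - xc|}) (fun x => ENNReal.ofReal (e (fun t y => ψ t y - p t y) 0 x))) ≤ Filter.liminf Eext Filter.atTop + Filter.liminf Eext Filter.atBot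

/-- `FixedModeChannels` holds: proved by `Summit.FinalStateConjecture.FinalStateConjecture.Theorems.fixedModeChannels_proof`. -/
theorem FixedModeChannels_holds : FixedModeChannels := _root_.Summit.FinalStateConjecture.FinalStateConjecture.Theorems.fixedModeChannels_proof

-- earlier Assembly (stmt-FinalStateConjecture-10050, replaced 2026-08-15T22:52:39Z -> stmt-FinalStateConjecture-13914): proved by Summit.FinalStateConjecture.FinalStateConjecture.Theorems.assembly_proof @ d725233c9ffd — UniformPhotonSphereChannels → ChannelsResolveTameDevelopments → TameCensorship → _root_.FinalStateConjecture
-- earlier Assembly (stmt-FinalStateConjecture-13914, replaced 2026-08-16T02:38:50Z -> stmt-FinalStateConjecture-14078): proved by Summit.FinalStateConjecture.FinalStateConjecture.Theorems.PhotonSphereChannels.assembly_frame_proof — UniformPhotonSphereChannels ∧ ChannelsResolveTameDevelopments ∧ TameCensorship → _root_.FinalStateConjecture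
-- earlier Assembly (stmt-FinalStateConjecture-14078, replaced 2026-08-16T23:19:00Z -> stmt-FinalStateConjecture-17432): proved by Summit.FinalStateConjecture.FinalStateConjecture.Theorems.PhotonSphereChannels.assemblyR_frame_proof — UniformPhotonSphereChannelsR ∧ ChannelsResolveTameDevelopmentsR ∧ TameCensorship → _root_.FinalStateConjecture
/-- item stmt-FinalStateConjecture-17432 · assembly · rank 1 · closed · proved by Summit.FinalStateConjecture.FinalStateConjecture.Theorems.PhotonSphereChannels.assemblyT2_frame_proof (prover) · by planner
sources: Christodoulou1999, DafermosLuk2017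
[assembly] frame of the deciding theorem after the T2 re-type: literally `fun h => closes h.1 h.2.1
h.2.2` over the restated K2R/K3; δ-equal to the landed Theses-free frame
`Summit.FinalStateConjecture.FinalStateConjecture.Theorems.PhotonSphereChannels.assemblyT2_frame_proof`
(Theorems/PhotonSphereChannelsAssemblyFrameT2.lean; checked: `example : Assembly :=
…assemblyT2_frame_proof` in the planner's Sketch.lean, rc 0) — close it with that decl, no new file
needed. Re-keyed (parenthesised antecedent) because the rev-7 text of
stmt-FinalStateConjecture-14078 is name-identical while its constituents were restated; stmt-14078's
recorded proof `assemblyR_frame_proof` (PhotonSphereChannelsAssemblyFrameR.lean) no longer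
elaborates against the re-typed summit (farm: type mismatch
IsChristodoulouGeneric/IsTameChristodoulouGeneric at l.79) and that module is dropped from the route
imports. -/
@[route_item "route-FinalStateConjecture-PhotonSphereChannels"]
def Assembly : Prop :=
  (UniformPhotonSphereChannelsR ∧ ChannelsResolveTameDevelopmentsR ∧ TameCensorship) → _root_.FinalStateConjecture

/-- `Assembly` holds: proved by `Summit.FinalStateConjecture.FinalStateConjecture.Theorems.PhotonSphereChannels.assemblyT2_frame_proof`. -/
theorem Assembly_holds : Assembly := _root_.Summit.FinalStateConjecture.FinalStateConjecture.Theorems.PhotonSphereChannels.assemblyT2_frame_proof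

-- records of items no longer active in this route (dropped / restated):
-- earlier UniformPhotonSphereChannels (stmt-FinalStateConjecture-10045, dropped 2026-08-16T02:38:50Z): refuted by Summit.FinalStateConjecture.FinalStateConjecture.Theorems.not_UniformPhotonSphereChannels — ∀ M : ℝ, 0 < M → ∃ ρ₀ : ℝ, 0 ≤ ρ₀ ∧ ∃ c : ℝ, 0 < c ∧ ∀ (r : ℝ → ℝ) (xc : ℝ), (∀ x, 2 * M < r x) → (∀ x, HasDerivAt r (1 - 2 * M / r x) x) → r xc = 3 * M → ∀ (s ℓ : ℕ), s ≤ 2 → s ≤ ℓ → ∀ ρ : ℝ, ρ₀ 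
-- earlier BlindnessInsidePhotonSphere (stmt-FinalStateConjecture-10049, dropped 2026-08-16T00:49:56Z): proved by Summit.FinalStateConjecture.FinalStateConjecture.Theorems.blindnessInsidePhotonSphere_proof @ d950baf76c44 — ∀ M : ℝ, 0 < M → ∀ (r : ℝ → ℝ) (xc : ℝ), (∀ x, 2 * M < r x) → (∀ x, HasDerivAt r (1 - 2 * M / r x) x) → r xc = 3 * M → ∀ xe : ℝ, xe < xc → ∀ ε : ℝ, 0 < ε → ∃ ℓ : ℕ, 2 ≤ ℓ ∧ ∃ ψ : ℝ

/-! D-0027 §2.1 — DECIDING THEOREM (planner-authored via `route open/edit --closes-file`; by planner-rrepair-FinalStateConjecture-PhotonSph-4a1b7431-0 2026-08-16T23:19:00Z):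
its hypotheses are this route's items and its conclusion the sub-problem Statement (glue_lint), and it elaborates with this file. -/

@[closes "route-FinalStateConjecture-PhotonSphereChannels"] theorem closes : UniformPhotonSphereChannelsR → ChannelsResolveTameDevelopmentsR → TameCensorship → _root_.FinalStateConjecture := by
  intro h₁ h₂ h₃ X i₁ i₂ i₃ i₄ i₅ i₆
  -- TAME Christodoulou-genericity (codimension 1, curve form, one fixed end; re-type T2 p126844) is
  -- monotone in the property: the witnessing end, family, tameness and immersion are kept verbatim,
  -- only the exceptional-set membership is transported
  have mono : ∀ {P Q : _ → Prop},
      (∀ D ∈ Literature.Geometry.Lorentzian.admissibleVacuumData X, Q D → P D) →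
      Literature.Geometry.Lorentzian.InitialDataSet.IsTameChristodoulouGeneric
        (Literature.Geometry.Lorentzian.admissibleVacuumData X) Q 1 →
      Literature.Geometry.Lorentzian.InitialDataSet.IsTameChristodoulouGeneric
        (Literature.Geometry.Lorentzian.admissibleVacuumData X) P 1 := by
    intro P Q hQP hQ D hD
    obtain ⟨e, F, hF, himm, h0, hinj, hadm, hexc⟩ := hQ D ⟨hD.1, fun h => hD.2 (hQP D hD.1 h)⟩
    exact ⟨e, F, hF, himm, h0, hinj, hadm,
      fun c hc hmem => hexc c hc ⟨hmem.1, fun h => hmem.2 (hQP _ hmem.1 h)⟩⟩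
  refine mono ?_ (h₃ X)
  -- pointwise on admissible data: (MGHD exists) ∧ (complete 𝓘⁺ ∧ no extremal remnant ∧ tame outer
  -- region) ⇒ the T2 final-state property; K1R feeds the re-typed conditional resolution K2R, whose
  -- conclusion now carries the ray-closure, honest-radii exhaustiveness and future-orientation clauses
  rintro D hD ⟨hex, hQ⟩
  refine ⟨hex, fun 𝒟 hmax => ?_⟩
  obtain ⟨hcomp, htame⟩ := hQ 𝒟 hmax
  obtain ⟨O, d, hO, hrays, hexh, hfo⟩ := h₂ h₁ X D hD 𝒟 hmax hcomp htame
  refine ⟨hcomp, O, d, fun i => ?_, hO, hrays, hexh, hfo⟩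
  -- sub-extremality of every hole: |aᵢ| ≤ Mᵢ structurally, and |aᵢ| = Mᵢ is an extremal remnant
  rcases lt_or_eq_of_le (d.abs_spin_le_mass i) with hlt | heq
  · exact hlt
  · exact absurd ⟨d.τ₀, d.chart i, ⟨(d.isLateChart i).contMDiff, (d.isLateChart i).isOpenEmbedding,
        Set.subset_univ _⟩, d.tendsto_truncDeviationCk i⟩
      (htame.1 (d.motion i).1 (d.motion i).2 (d.mass i) (d.spin i) ⟨heq, d.mass_pos i⟩)

end Summit.FinalStateConjecture.FinalStateConjecture.Theses.PhotonSphereChannels
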